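/-
Origin: expansion seat `planner-pub-hodgecm-pv13-0`, handover 2026-08-18T04:11:46Z (`HOME/pub-hodgecm-pv13/lean/Pv13/LocalFactorPieces.lean`, md5 033325c1, 222 lines);
landed by the gen-5 packager in gate run 21 as `HodgeCM/PerL34/LocalFactorPieces.lean` (import ^import Pv[0-9]+\.→import HodgeCM.PerL34. ×1).
-/
/-
Origin: pub-hodgecm-pv13 (DAG-NODE PROVER #13) — the S3 constructor of the carver's SEAM TABLE (LEMMAS.md §9, v4):
`EulerProduct.LocalFactorDatum` BUILT from the producers' conclusions (pv09 N31e statement, pv05 Petersson norm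
identity) + this seat's restricted-product `EulerFactorisation.Datum` + the remaining local fields, with the `rallis`
field no longer an input.  Also the kernel REALITY of local factors (tex l. 612 "real").
Imports `Pv13.RallisEuler` (→ `HodgeCM.PerL34.RallisEuler`).  Proposed place: `HodgeCM/PerL34/LocalFactorPieces.lean`,
namespace `HodgeCM.PerL34.EulerFactorisation`.  Nothing cited, nothing asserted.
-/
import Summits.HodgeConjecture.HodgeCM.PerL34.RallisEuler
import Mathlib.MeasureTheory.Group.Integral

set_option autoImplicit false

/-!
# `LocalFactorDatum` from pieces (seam S3 / (I) closed by name, one more input discharged in kernel)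

* `integral_eq_re_of_inv_conj` — KERNEL (l. 612 "with `I_v(φ_v)` real"): on a group with an inversion-invariant
  measure, an integrand with `f(y⁻¹) = conj (f y)` has real integral; `matrixCoeff_inv_conj` — the local
  integrand `⟪φ_v, ω_v(y)φ_v⟫ χ'_v(y)` (ω_v unitary, χ'_v a unitary character) has this symmetry.  Hence
  `LocalIntegrand.integral_real`: `I_v(φ_v) ∈ ℝ` with NO hypothesis.
* `LocalFactorPieces V E` — the INPUTS of one `LocalFactorDatum` in produced form: the adelic shell
  `(A, μ, 𝓕, ω, φ, χ', K)` of pv09/pv05 with `hN31e : RallisIP.N31e_statement …` and the Petersson identity `hnorm`,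
  a restricted-product `Datum` for the matrix coefficient whose local integrals are given as `LocalIntegrand`s
  (so their reality is a theorem), and the N31f/N31g local fields (`ram_pos`, `split_val`, `nonsplit_val`, …).
* `LocalFactorPieces.toLocalFactorDatum` — the constructor; `rallis` := `rallis_of_pieces`, `vol_pos` from
  `μ 𝓕 ≠ 0, ≠ ⊤`.  So `SideOutputs`/`ClusterOutputs` (CharsAssembly) can be fed from pieces per character.
-/

noncomputable section

open MeasureTheory Complex ComplexConjugate
open scoped InnerProductSpace

namespace HodgeCM
namespace PerL34
namespace EulerFactorisation

/-! ### 1. Reality of local factors (l. 612) — kernel -/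

section Reality

variable {G : Type*} [Group G] [MeasurableSpace G] [MeasurableInv G]

/-- An integrand with `f(y⁻¹) = conj (f y)` over an inversion-invariant measure has REAL integral. -/
theorem integral_eq_re_of_inv_conj (μ : Measure G) [μ.IsInvInvariant] {f : G → ℂ}
    (hf : ∀ y, f y⁻¹ = conj (f y)) : ∫ y, f y ∂μ = ((∫ y, f y ∂μ).re : ℂ) := by
  have h : conj (∫ y, f y ∂μ) = ∫ y, f y ∂μ := by
    rw [← integral_conj]
    simp_rw [← hf]
    exact integral_inv_eq_self f μ
  exact (Complex.conj_eq_iff_re.mp h).symm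

variable {Sp : Type*} [NormedAddCommGroup Sp] [InnerProductSpace ℂ Sp]

omit [MeasurableSpace G] [MeasurableInv G] in
/-- The local matrix-coefficient integrand `y ↦ ⟪φ, ω(y)φ⟫ χ(y)` of a UNITARY representation and a unitary
character satisfies `f(y⁻¹) = conj (f y)`. -/
theorem matrixCoeff_inv_conj (ω : G →* (Sp ≃ₗᵢ[ℂ] Sp)) (φ : Sp) {χ : G → ℂ} (hχ : ∀ y, χ y⁻¹ = conj (χ y))
    (y : G) : ⟪φ, ω y⁻¹ φ⟫_ℂ * χ y⁻¹ = conj (⟪φ, ω y φ⟫_ℂ * χ y) := by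
  rw [map_mul, ← hχ y, map_inv, LinearIsometryEquiv.coe_inv]
  congr 1
  rw [← (ω y).inner_map_map φ ((ω y).symm φ), LinearIsometryEquiv.apply_symm_apply, inner_conj_symm]

/-- A local integrand in matrix-coefficient form: group `G_v`, inversion-invariant measure, unitary `ω_v`,
vector `φ_v`, unitary character values `χ_v` (only `χ_v(y⁻¹) = conj χ_v(y)` is used). -/
structure LocalIntegrand where
  G : Type
  [grp : Group G]
  [meas : MeasurableSpace G]
  [measInv : MeasurableInv G]
  μ : Measure G
  [invInv : μ.IsInvInvariant]
  Sp : Type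
  [nSp : NormedAddCommGroup Sp]
  [ipSp : InnerProductSpace ℂ Sp]
  ω : G →* (Sp ≃ₗᵢ[ℂ] Sp)
  φ : Sp
  χ : G → ℂ
  chi_inv : ∀ y, χ y⁻¹ = conj (χ y)

namespace LocalIntegrand

attribute [instance] LocalIntegrand.grp LocalIntegrand.meas LocalIntegrand.measInv LocalIntegrand.invInv
  LocalIntegrand.nSp LocalIntegrand.ipSp

variable (L : LocalIntegrand)

/-- the integrand `f_v(y) = ⟪φ_v, ω_v(y) φ_v⟫ χ_v(y)` -/
def f (y : L.G) : ℂ := ⟪L.φ, L.ω y L.φ⟫_ℂ * L.χ y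

/-- the local factor `I_v(φ_v) = ∫ f_v` as a complex number … -/
def Ic : ℂ := ∫ y, L.f y ∂L.μ

/-- … and as the real number it is -/
def I : ℝ := L.Ic.re

/-- **l. 612, kernel**: `I_v(φ_v)` is real. -/
theorem integral_real : L.Ic = (L.I : ℂ) :=
  integral_eq_re_of_inv_conj L.μ fun y => matrixCoeff_inv_conj L.ω L.φ L.chi_inv y

end LocalIntegrand

end Reality

/-! ### 2. The pieces of one local-factor datum and the constructor -/

variable (V : Type) [Countable V] (E : Type*) [NormedAddCommGroup E] [InnerProductSpace ℂ E]

/-- **Pieces of a `LocalFactorDatum`** (one candidate `(W_i, μ_i, χ'_i)`, one `φ = ⊗φ_v`): the produced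
statements of the N31 chain and the remaining local data; NO `rallis` field. -/
structure LocalFactorPieces where
  /-- adelic shell of pv09/pv05: `A = U(W_i)(𝔸)` (commutative: `U(1)`), Tamagawa-type measure, fundamental
  domain `𝓕` for `[U(W_i)]`, the Weil representation `ω` (unitary), `φ`, `χ'`, the `[G_U]`-inner kernel `K` -/
  A : Type
  [grpA : CommGroup A]
  [measA : MeasurableSpace A]
  μ : Measure A
  𝓕 : Set A
  Sp : Type
  [nSp : NormedAddCommGroup Sp]
  [ipSp : InnerProductSpace ℂ Sp]
  ω : A →* (Sp ≃ₗᵢ[ℂ] Sp)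
  φ : Sp
  χ' : A → ℂ
  K : A → A → ℂ
  /-- Weil's constant (N31d) and its positivity -/
  c : ℝ
  c_pos : 0 < c
  /-- `[U(W_i)]` has positive finite volume (compact quotient, Haar measure) -/
  vol_ne_zero : μ 𝓕 ≠ 0
  vol_ne_top : μ 𝓕 ≠ ⊤
  /-- the theta lift and the set of all lifts -/
  theta : E
  Theta : Set E
  theta_mem : theta ∈ Theta
  /-- PRODUCED by pv09 (`RallisIP.N31e_holds` over the doubling shell): N31e -/
  hN31e : RallisIP.N31e_statement μ 𝓕 ω φ χ' K (c : ℂ)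
  /-- PRODUCED by pv05 (`PeterssonFubini`): the Petersson norm of the lift as the double integral -/
  hnorm : ⟪theta, theta⟫_ℂ = ∫ u in 𝓕, ∫ u' in 𝓕, χ' u * conj (χ' u') * K u u' ∂μ ∂μ
  /-- the local integrands `(U(W_i)(L_{0,v}), dy_v, ω_v, φ_v, χ'_v)` -/
  loc : V → LocalIntegrand
  /-- restricted-product structure of `(A, μ)` and `ω = ⊗' ω_v`, `φ = ⊗ φ_v`, `χ' = ∏ χ'_v` (this seat's typed
  data), with local pieces READ OFF `loc` -/
  D : Datum μ (fun y => ⟪φ, ω y φ⟫_ℂ * χ' y) V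
  D_I : ∀ v, D.I v = (loc v).Ic
  /-- the N31f/N31g local fields, verbatim as in `LocalFactorDatum` -/
  S : Finset V
  q : V → ℕ
  chiPi : V → ℂ
  nuPi : V → ℂ
  IsSplit : V → Prop
  two_le_q : ∀ v, v ∉ S → 2 ≤ q v
  chi_norm : ∀ v, v ∉ S → ‖chiPi v‖ = 1
  nu_norm : ∀ v, v ∉ S → ‖nuPi v‖ = 1
  ram_pos : ∀ v ∈ S, 0 < (loc v).I
  split_val : ∀ v, v ∉ S → IsSplit v →
    ((loc v).I : ℂ) = ∑' n : ℤ, ((EulerProduct.tOf (q v) : ℝ) : ℂ) ^ n.natAbs * (chiPi v * nuPi v) ^ n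
  nonsplit_val : ∀ v, v ∉ S → ¬IsSplit v → (loc v).I = 1
  summable_t : Summable fun v : {w : V // w ∉ S} => EulerProduct.tOf (q v.1)

namespace LocalFactorPieces

attribute [instance] LocalFactorPieces.grpA LocalFactorPieces.measA LocalFactorPieces.nSp LocalFactorPieces.ipSp

variable {V E} (P : LocalFactorPieces V E)

/-- the real local factors -/
def I (v : V) : ℝ := (P.loc v).I

/-- (Ported verbatim from the HodgeCMPerL package; no docstring in the source.) -/
theorem D_I_real (v : V) : P.D.I v = (P.I v : ℂ) := by
  rw [P.D_I v, (P.loc v).integral_real]; rfl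

/-- (Ported verbatim from the HodgeCMPerL package; no docstring in the source.) -/
theorem tailHyps : EulerProduct.TailHyps P.S P.I P.q (fun v => P.chiPi v * P.nuPi v) P.IsSplit where
  two_le_q := P.two_le_q
  a_norm v hv := EulerProduct.norm_mul_eq_one (P.chi_norm v hv) (P.nu_norm v hv)
  split_val := P.split_val
  nonsplit_val := P.nonsplit_val

/-- `vol([U(W_i)]) := (μ 𝓕).toReal > 0` -/
theorem vol_pos : 0 < (P.μ P.𝓕).toReal := ENNReal.toReal_pos P.vol_ne_zero P.vol_ne_top

/-- **The `rallis` field is PRODUCED**: `re ⟪θ,θ⟫ = c · vol · ∏' v, I_v`. -/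
theorem rallis : RCLike.re ⟪P.theta, P.theta⟫_ℂ = P.c * (P.μ P.𝓕).toReal * ∏' v, P.I v :=
  rallis_of_pieces rfl P.hN31e P.hnorm P.D P.D_I_real P.tailHyps P.summable_t

/-- **The S3 constructor**: a `LocalFactorDatum` all of whose statement fields are produced or local. -/
def toLocalFactorDatum : EulerProduct.LocalFactorDatum V E where
  I := P.I
  S := P.S
  q := P.q
  chiPi := P.chiPi
  nuPi := P.nuPi
  IsSplit := P.IsSplit
  c := P.c
  vol := (P.μ P.𝓕).toReal
  c_pos := P.c_pos
  vol_pos := P.vol_pos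
  theta := P.theta
  Theta := P.Theta
  theta_mem := P.theta_mem
  two_le_q := P.two_le_q
  chi_norm := P.chi_norm
  nu_norm := P.nu_norm
  ram_pos := P.ram_pos
  split_val := P.split_val
  nonsplit_val := P.nonsplit_val
  summable_t := P.summable_t
  rallis := P.rallis

/-- (Ported verbatim from the HodgeCMPerL package; no docstring in the source.) -/
@[simp] theorem toLocalFactorDatum_theta : P.toLocalFactorDatum.theta = P.theta := rfl
/-- (Ported verbatim from the HodgeCMPerL package; no docstring in the source.) -/
@[simp] theorem toLocalFactorDatum_Theta : P.toLocalFactorDatum.Theta = P.Theta := rfl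

/-- N31h (i) for the pieces: `θ_φ(χ') ≠ 0`. -/
theorem theta_ne_zero : P.theta ≠ 0 := P.toLocalFactorDatum.theta_ne_zero

end LocalFactorPieces

end EulerFactorisation
end PerL34
end HodgeCM

end
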